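import Mathlib
import Summits.KontsevichZagierPeriods.Zeta5Search.Families.IntegrabilityNecessity
import Summits.KontsevichZagierPeriods.Zeta5Search.Families.CellularEdges
import Summits.KontsevichZagierPeriods.Zeta5Search.Families.BasicConvergenceGeneral
import HarnessLib

/-!
# ζ(5) search — Families: Brown's convergence criterion, analytic half — `BrownConvergent ⇒ integrable`

HONEST FRAMING: systematic search; no irrationality claim unless certified.  This file contains NO statement about
zeta values (it is about CONVERGENCE of the generalised cellular integrals, the index set of the cellular search).

`Families/CellularIntegral.lean` typed Brown's COMBINATORIAL convergence condition `BrownConvergent σ a b`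
("`2·ord_D(f_σ(a,b) ω_σ) ≥ 0` along every divisor `D` at finite distance", [Brown2016, §2.4 (2.3), §3.4 (3.8),
Lemma 3.11, Def. 5.1]) and left its identification with integrability NOT ASSERTED.  Here (seat P2, files
`SectorIntegrals`, `GapCoordinates`, `EdgePowers`, `SectorBounds`, `SimplexPowerIntegrability`, `CellularEdges` and
this one) the direction used by every family of the search is PROVED:

* `twoOrd_eq_twoOrdSet_arc` — Brown's valuation depends on the chord only through its vertex set `S`;
* `twoOrdSet_eq_two_mul` — **for a bijective seating and HOMOGENEOUS exponents** [Brown2016, §5.1 (5.2)],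
  `2·ord_{D_S} = 2·(s(S) − 1)` with the block exponent `s(S) = |S| − 1 + Σ_{δ-edges ⊆ S} a − Σ_{σ-edges ⊆ S}(b + 1)`
  for EVERY vertex set `S` (double counting of the homogeneity equations over the vertices of `S` and of `Sᶜ`);
* `crit_of_brownConvergent` — hence `BrownConvergent` gives the block criterion of `EdgePowers` for the cellular
  edge family (`CellularEdges`), every linear block of `2,…,n−2` finite points being a chord set;
* **`integrableOn_integrand_of_brownConvergent`** — for bijective `σ`, `Homogeneous σ a b` and `BrownConvergent σ a b`,
  the generalised cellular integrand `f_σ(a,b) ω_σ` is INTEGRABLE on the open simplex, so `integral σ a b` is a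
  genuine (positive, `integral_pos`) convergent integral [Brown2016, Lemma 3.6 / Def. 5.1: "no poles along
  `δ⁰_f` ⇒ the integral converges"]; **`integrableOn_basic_of_convergent`** — the basic cellular integral `I_σ(N)`,
  `N ≥ 0`, of every CONVERGENT seating converges [Brown2016, §1.5 "It converges if … `σ` is a convergent
  permutation", Lemma 3.6], via `brownConvergent_basic_of_convergent` (`BasicConvergenceGeneral`).
With the converse of `IntegrabilityNecessity` (poles ⇒ divergence) and the complement symmetry of chords this gives
the full identification **`integrableOn_integrand_iff_brownConvergent`** (bijective `σ`, homogeneous exponents) and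
**`integrableOn_basic_iff_convergent`**: the basic cellular integral `I_σ(N)`, `N ≥ 0`, converges IFF `σ` is a
convergent seating [Brown2016, §1.5, Lemma 3.6].  Standard axioms only.
-/

noncomputable section

open MeasureTheory Set Finset

namespace Summit.KontsevichZagierPeriods.Zeta5Search.Families.Cellular

variable {ℓ : ℕ} (σ : Fin (ℓ + 3) → Fin (ℓ + 3)) (a b : Fin (ℓ + 3) → ℤ)

/-! ### Valuations as functions of the chord's vertex set -/

/-- `δ⁰`-edges inside `S`, weighted by `a`. -/
def aIn (S : Finset (Fin (ℓ + 3))) : ℤ := ∑ i, if i ∈ S ∧ i + 1 ∈ S then a i else 0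

/-- `σδ⁰`-edges inside `S`, weighted by `b + 1`. -/
def bIn (S : Finset (Fin (ℓ + 3))) : ℤ := ∑ i, if σ i ∈ S ∧ σ (i + 1) ∈ S then b i + 1 else 0

/-- `δ⁰`-edges crossing the cut `S | Sᶜ`, weighted by `a`. -/
def aCross (S : Finset (Fin (ℓ + 3))) : ℤ := ∑ i, if ¬ (i ∈ S ↔ i + 1 ∈ S) then a i else 0

/-- `σδ⁰`-edges crossing the cut, weighted by `b + 1`. -/
def bCross (S : Finset (Fin (ℓ + 3))) : ℤ := ∑ i, if ¬ (σ i ∈ S ↔ σ (i + 1) ∈ S) then b i + 1 else 0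

/-- The block exponent `s(S) = |S| − 1 + aIn − bIn`. -/
def blockExp (S : Finset (Fin (ℓ + 3))) : ℤ := (S.card : ℤ) - 1 + aIn a S - bIn σ b S

/-- Brown's doubled valuation as a function of the vertex set of the chord. -/
def twoOrdSet (S : Finset (Fin (ℓ + 3))) : ℤ :=
  (∑ i, if (i ∈ S ↔ i + 1 ∈ S) then a i else 0) - (∑ i, if (σ i ∈ S ↔ σ (i + 1) ∈ S) then b i + 1 else 0) +
    ((ℓ : ℤ) - 1)

/-- `twoOrd` depends on the chord `(p,k)` only through its arc `S = {p,…,p+k−1}`. [Brown2016, §3.4 (3.8)] -/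
theorem twoOrd_eq_twoOrdSet_arc (p : Fin (ℓ + 3)) (k : ℕ) :
    twoOrd σ a b p k = twoOrdSet σ a b (arc p k) := by
  unfold twoOrd twoOrdSet
  simp_rw [sameSide_eq_ite]
  simp only [ite_mul, one_mul, zero_mul]

/-! ### Double counting over the vertices of `S` -/

/-- Summing an edge weight over the two edges at each vertex of `S` (along the Hamiltonian cycle `τ`) counts the
edges inside `S` twice and the crossing edges once. -/
theorem double_count (τ : Fin (ℓ + 3) → Fin (ℓ + 3)) (w : Fin (ℓ + 3) → ℤ) (S : Finset (Fin (ℓ + 3))) :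
    ∑ i, (if τ i ∈ S then w (i - 1) + w i else 0) =
      2 * (∑ i, if τ i ∈ S ∧ τ (i + 1) ∈ S then w i else 0) +
        ∑ i, if ¬ (τ i ∈ S ↔ τ (i + 1) ∈ S) then w i else 0 := by
  have hsplit : ∀ i, (if τ i ∈ S then w (i - 1) + w i else 0) =
      (if τ i ∈ S then w (i - 1) else 0) + (if τ i ∈ S then w i else 0) := fun i => by
    split_ifs <;> simp
  have hshift : ∑ i, (if τ i ∈ S then w (i - 1) else 0) = ∑ i, (if τ (i + 1) ∈ S then w i else 0) := by
    rw [← Equiv.sum_comp (Equiv.addRight (1 : Fin (ℓ + 3))) (fun i => if τ i ∈ S then w (i - 1) else 0)]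
    simp only [Equiv.coe_addRight, add_sub_cancel_right]
  simp_rw [hsplit]
  rw [Finset.sum_add_distrib, hshift, Finset.mul_sum, ← Finset.sum_add_distrib, ← Finset.sum_add_distrib]
  refine Finset.sum_congr rfl fun i _ => ?_
  by_cases h1 : τ i ∈ S
  · by_cases h2 : τ (i + 1) ∈ S
    · simp [h1, h2]; ring
    · simp [h1, h2]
  · by_cases h2 : τ (i + 1) ∈ S
    · simp [h1, h2]
    · simp [h1, h2]

/-- For a bijective relabelling, sums of vertex functions over `{i | σ i ∈ S}` are sums over `S`. -/
theorem sum_ite_comp_eq (hσ : Function.Bijective σ) (S : Finset (Fin (ℓ + 3))) (g : Fin (ℓ + 3) → ℤ) :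
    ∑ i, (if σ i ∈ S then g (σ i) else 0) = ∑ v, (if v ∈ S then g v else 0) :=
  hσ.sum_comp (fun v => if v ∈ S then g v else 0)

/-- The homogeneity equations summed over the vertices of `S`:
`2·aIn S + aCross S = 2·bIn S + bCross S − 2|S|`. [Brown2016, §5.1 (5.2), double-counted] -/
theorem hom_sum (hσ : Function.Bijective σ) (hh : Homogeneous σ a b) (S : Finset (Fin (ℓ + 3))) :
    2 * aIn a S + aCross a S = 2 * bIn σ b S + bCross σ b S - 2 * S.card := by
  -- sum `a (σ i − 1) + a (σ i) = (b (i−1) + 1) + (b i + 1) − 2` over `σ i ∈ S`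
  have hpt : ∀ i, (if σ i ∈ S then a (σ i - 1) + a (σ i) else 0) =
      (if σ i ∈ S then (b (i - 1) + 1) + (b i + 1) else 0) - (if σ i ∈ S then 2 else 0) := fun i => by
    by_cases h : σ i ∈ S
    · rw [if_pos h, if_pos h, if_pos h, hh i]; ring
    · rw [if_neg h, if_neg h, if_neg h]; ring
  have hL : ∑ i, (if σ i ∈ S then a (σ i - 1) + a (σ i) else 0) = 2 * aIn a S + aCross a S := by
    rw [sum_ite_comp_eq σ hσ S (fun v => a (v - 1) + a v)]
    exact double_count id a S
  have hR : ∑ i, (if σ i ∈ S then (b (i - 1) + 1) + (b i + 1) else 0) = 2 * bIn σ b S + bCross σ b S :=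
    double_count σ (fun i => b i + 1) S
  have hC : ∑ i, (if σ i ∈ S then (2 : ℤ) else 0) = 2 * S.card := by
    rw [sum_ite_comp_eq σ hσ S (fun _ => 2), ← Finset.sum_filter, Finset.filter_mem_eq_inter, Finset.univ_inter,
      Finset.sum_const, nsmul_eq_mul, mul_comm]
  have := congrArg (fun f => ∑ i, f i) (funext hpt)
  simp only [Finset.sum_sub_distrib] at this
  rw [hL, hR, hC] at this
  linarith

/-- Crossing sums do not see which side is which. -/
theorem aCross_compl (S : Finset (Fin (ℓ + 3))) : aCross a Sᶜ = aCross a S := by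
  unfold aCross
  refine Finset.sum_congr rfl fun i _ => ?_
  simp only [Finset.mem_compl, not_iff_not]

/-- Crossing sums do not see which side is which (`σδ⁰`-edges). -/
theorem bCross_compl (S : Finset (Fin (ℓ + 3))) : bCross σ b Sᶜ = bCross σ b S := by
  unfold bCross
  refine Finset.sum_congr rfl fun i _ => ?_
  simp only [Finset.mem_compl, not_iff_not]

/-- **Homogeneity identity**: for a bijective seating and homogeneous exponents, Brown's doubled valuation along the
chord with vertex set `S` is `2·(s(S) − 1)`, for EVERY vertex set `S`. [Brown2016, §3.4 (3.8) + §5.1 (5.2)] -/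
theorem twoOrdSet_eq_two_mul (hσ : Function.Bijective σ) (hh : Homogeneous σ a b) (S : Finset (Fin (ℓ + 3))) :
    twoOrdSet σ a b S = 2 * (blockExp σ a b S - 1) := by
  have hS := hom_sum σ a b hσ hh S
  have hSc := hom_sum σ a b hσ hh Sᶜ
  rw [aCross_compl, bCross_compl] at hSc
  have hcard : (Sᶜ.card : ℤ) = (ℓ + 3 : ℤ) - S.card := by
    rw [Finset.card_compl, Fintype.card_fin]
    have := S.card_le_univ; rw [Fintype.card_fin] at this
    omega
  -- `[x ∈ S ↔ y ∈ S] = [x ∈ S ∧ y ∈ S] + [x ∈ Sᶜ ∧ y ∈ Sᶜ]`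
  have hsplitA : (∑ i, if (i ∈ S ↔ i + 1 ∈ S) then a i else 0) = aIn a S + aIn a Sᶜ := by
    unfold aIn
    rw [← Finset.sum_add_distrib]
    refine Finset.sum_congr rfl fun i _ => ?_
    by_cases h1 : i ∈ S <;> by_cases h2 : i + 1 ∈ S <;> simp [h1, h2]
  have hsplitB : (∑ i, if (σ i ∈ S ↔ σ (i + 1) ∈ S) then b i + 1 else 0) = bIn σ b S + bIn σ b Sᶜ := by
    unfold bIn
    rw [← Finset.sum_add_distrib]
    refine Finset.sum_congr rfl fun i _ => ?_
    by_cases h1 : σ i ∈ S <;> by_cases h2 : σ (i + 1) ∈ S <;> simp [h1, h2]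
  unfold twoOrdSet blockExp
  rw [hsplitA, hsplitB]
  rw [hcard] at hSc
  linarith

/-! ### Chord sets of linear blocks of finite points -/

/-- The block of finite points `{z_p, …, z_q}`. -/
def vblock (ℓ p q : ℕ) : Finset (Fin (ℓ + 3)) := univ.filter fun v => p ≤ v.val ∧ v.val ≤ q

/-- Membership in a block of finite points. -/
@[simp] theorem mem_vblock (p q : ℕ) (v : Fin (ℓ + 3)) : v ∈ vblock ℓ p q ↔ p ≤ v.val ∧ v.val ≤ q := by
  simp [vblock]

/-- A block of finite points has `q + 1 − p` elements (`q ≤ ℓ + 1`). -/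
theorem card_vblock (p q : ℕ) (hq : q ≤ ℓ + 1) : (vblock ℓ p q).card = q + 1 - p := by
  rw [vblock]
  have : (univ.filter fun v : Fin (ℓ + 3) => p ≤ v.val ∧ v.val ≤ q) =
      (Finset.Icc p q).attachFin (fun w hw => by have := (Finset.mem_Icc.1 hw).2; omega) := by
    ext w; simp
  rw [this, Finset.card_attachFin, Nat.card_Icc]

/-- A linear block of finite points is Brown's arc `{p, …, p+k−1}` with `k = q − p + 1`. -/
theorem arc_eq_vblock {p q : ℕ} (hpq : p < q) (hq : q ≤ ℓ + 1) :
    arc (⟨p, by omega⟩ : Fin (ℓ + 3)) (q - p + 1) = vblock ℓ p q := by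
  ext v
  rw [mem_arc, mem_vblock]
  by_cases h : (⟨p, by omega⟩ : Fin (ℓ + 3)) ≤ v
  · have h1 := Fin.coe_sub_iff_le.2 h
    have h2 : p ≤ v.val := h
    simp only at h1
    rw [h1]; omega
  · have h1 := Fin.coe_sub_iff_lt.2 (not_le.1 h)
    have h2 : v.val < p := not_le.1 h
    simp only at h1
    rw [h1]; have := v.isLt; omega

/-- The block functional of the cellular edge family on the run `[p,q)` is the block exponent of `{z_p,…,z_q}`. -/
theorem blockSum_eq_blockExp (hσ : Function.Injective σ) {p q : ℕ} (hpq : p < q) (hq : q ≤ ℓ + 1) :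
    (cellEdges σ hσ).blockSum (cellExp σ a b) (gapRun ℓ p q) = (blockExp σ a b (vblock ℓ p q) : ℝ) := by
  rw [blockSum_cellEdges σ hσ a b hq]
  unfold blockExp aIn bIn
  rw [card_vblock p q hq]
  have hA : (∑ i : Fin (ℓ + 3), if p ≤ i.val ∧ i.val + 1 ≤ q then (a i : ℝ) else 0) =
      ((∑ i : Fin (ℓ + 3), if i ∈ vblock ℓ p q ∧ i + 1 ∈ vblock ℓ p q then a i else 0 : ℤ) : ℝ) := by
    push_cast
    refine Finset.sum_congr rfl fun i _ => ?_
    have hiff : (p ≤ i.val ∧ i.val + 1 ≤ q) ↔ (i ∈ vblock ℓ p q ∧ i + 1 ∈ vblock ℓ p q) := by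
      rw [mem_vblock, mem_vblock, Fin.val_add_one]
      split_ifs with hl
      · rw [hl, Fin.val_last]; omega
      · omega
    simp only [hiff]
  have hB : (∑ i : Fin (ℓ + 3), if p ≤ min (σ i).val (σ (i + 1)).val ∧ max (σ i).val (σ (i + 1)).val ≤ q
        then ((b i : ℝ) + 1) else 0) =
      ((∑ i : Fin (ℓ + 3), if σ i ∈ vblock ℓ p q ∧ σ (i + 1) ∈ vblock ℓ p q then b i + 1 else 0 : ℤ) : ℝ) := by
    push_cast
    refine Finset.sum_congr rfl fun i _ => ?_
    have hiff : (p ≤ min (σ i).val (σ (i + 1)).val ∧ max (σ i).val (σ (i + 1)).val ≤ q) ↔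
        (σ i ∈ vblock ℓ p q ∧ σ (i + 1) ∈ vblock ℓ p q) := by
      rw [mem_vblock, mem_vblock]; omega
    simp only [hiff]
  rw [hA, hB]
  push_cast
  have : ((q - p : ℕ) : ℝ) = ((q + 1 - p : ℕ) : ℝ) - 1 := by
    rw [show q + 1 - p = (q - p) + 1 by omega]; push_cast; ring
  linarith [this]

/-! ### The main theorems -/

/-- **Brown's condition gives the block criterion** (bijective `σ`, homogeneous exponents). -/
theorem crit_of_brownConvergent (hσ : Function.Bijective σ) (hh : Homogeneous σ a b) (hB : BrownConvergent σ a b) :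
    (cellEdges σ hσ.1).Crit (cellExp σ a b) := by
  intro p q hpq hq hqp
  have hk : q - p - 1 < ℓ := by omega
  have h := hB ⟨p, by omega⟩ ⟨q - p - 1, hk⟩
  have hk2 : ((⟨q - p - 1, hk⟩ : Fin ℓ) : ℕ) + 2 = q - p + 1 := by simp only; omega
  rw [hk2] at h
  change 0 ≤ twoOrd σ a b ((⟨p, by omega⟩ : Fin (ℓ + 3)) : ℕ) (q - p + 1) at h
  rw [twoOrd_eq_twoOrdSet_arc, arc_eq_vblock hpq hq, twoOrdSet_eq_two_mul σ a b hσ hh] at h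
  rw [blockSum_eq_blockExp σ a b hσ.1 hpq hq]
  have : (1 : ℤ) ≤ blockExp σ a b (vblock ℓ p q) := by linarith
  exact_mod_cast Int.lt_of_lt_of_le zero_lt_one this |>.trans_le le_rfl

/-- **Brown 2016, Lemma 3.6 / Def. 5.1, analytic half (direction "no poles ⇒ convergence")**: for a bijective
seating `σ` and homogeneous exponents, Brown's combinatorial condition `BrownConvergent σ a b` implies that the
generalised cellular integrand `f_σ(a,b) ω_σ` is integrable on the open simplex. [Brown2016, §2.4 (2.3), Lemma 3.6,
Def. 5.1] -/
theorem integrableOn_integrand_of_brownConvergent (hσ : Function.Bijective σ) (hh : Homogeneous σ a b)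
    (hB : BrownConvergent σ a b) : IntegrableOn (integrand σ a b) (openSimplex ℓ) :=
  (integrableOn_integrand_iff_powProd σ hσ.1 a b).2
    ((cellEdges σ hσ.1).integrableOn_powProd_of_crit (crit_of_brownConvergent σ a b hσ hh hB))

/-- Under the same hypotheses the generalised cellular integral is POSITIVE (a convergent integral of a positive
function; `ℓ ≥ 1`). -/
theorem integral_pos_of_brownConvergent (hℓ : 1 ≤ ℓ) (hσ : Function.Bijective σ) (hh : Homogeneous σ a b)
    (hB : BrownConvergent σ a b) : 0 < integral σ a b := by
  refine integral_pos hσ.1 a b (integrableOn_integrand_of_brownConvergent σ a b hσ hh hB) ?_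
  -- the open simplex has positive volume: it contains the cube-like set `cumsum (gapSet)`; use gap coordinates
  intro h0
  have h1 : ∫⁻ t in openSimplex ℓ, (1 : ENNReal) = 0 := by rw [setLIntegral_const, h0, mul_zero]
  rw [lintegral_openSimplex_eq_gapSet (fun _ => (1 : ENNReal)) measurable_const, setLIntegral_const, one_mul] at h1
  -- `gapSet ℓ` contains the box `(0, 1/(ℓ+1))^ℓ`
  have hsub : Set.pi univ (fun _ : Fin ℓ => Ioo (0 : ℝ) (1 / (ℓ + 1))) ⊆ gapSet ℓ := by
    intro h hh'
    simp only [mem_pi, mem_univ, Set.mem_Ioo, forall_true_left] at hh'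
    refine ⟨fun j => (hh' j).1, ?_⟩
    calc ∑ j, h j ≤ ∑ _j : Fin ℓ, (1 / (ℓ + 1 : ℝ)) := Finset.sum_le_sum fun j _ => (hh' j).2.le
      _ = ℓ * (1 / (ℓ + 1 : ℝ)) := by simp
      _ < 1 := by
          rw [mul_one_div, div_lt_one (by positivity)]
          linarith
  have hvol : volume (Set.pi univ (fun _ : Fin ℓ => Ioo (0 : ℝ) (1 / (ℓ + 1)))) ≠ 0 := by
    rw [volume_pi_pi]
    refine Finset.prod_ne_zero_iff.2 fun j _ => ?_
    rw [Real.volume_Ioo, Ne, ENNReal.ofReal_eq_zero, not_le]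
    have : (0 : ℝ) < 1 / (ℓ + 1) := by positivity
    linarith
  exact hvol (measure_mono_null hsub h1)

/-- **The basic cellular integral of every convergent seating converges** (`N ≥ 0`).
[Brown2016, §1.5: "It converges if and only if `σ` is a convergent permutation"; Lemma 3.6 — direction "if"] -/
theorem integrableOn_basic_of_convergent (hσ : Function.Bijective σ) (hc : Convergent σ) {N : ℤ} (hN : 0 ≤ N) :
    IntegrableOn (basic σ N) (openSimplex ℓ) :=
  integrableOn_integrand_of_brownConvergent σ _ _ hσ (homogeneous_const σ N) (brownConvergent_basic_of_convergent hσ hc hN)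

/-! ### The converse: the block criterion gives Brown's condition -/

/-- `twoOrdSet` is symmetric under complementation of the vertex set. -/
theorem twoOrdSet_compl (S : Finset (Fin (ℓ + 3))) : twoOrdSet σ a b Sᶜ = twoOrdSet σ a b S := by
  unfold twoOrdSet
  simp only [Finset.mem_compl, not_iff_not]

/-- The criterion makes every linear block of finite points have block exponent `≥ 1`. -/
theorem one_le_blockExp_of_crit (hσ : Function.Injective σ) (hc : (cellEdges σ hσ).Crit (cellExp σ a b))
    {p q : ℕ} (hpq : p < q) (hq : q ≤ ℓ + 1) (hqp : q - p ≤ ℓ) : 1 ≤ blockExp σ a b (vblock ℓ p q) := by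
  have h := hc p q hpq hq hqp
  rw [blockSum_eq_blockExp σ a b hσ hpq hq] at h
  have : (0 : ℤ) < blockExp σ a b (vblock ℓ p q) := by exact_mod_cast h
  omega

/-- The complement of an arc through `∞` is a linear block of finite points. -/
theorem compl_arc_eq_vblock (p : Fin (ℓ + 3)) {k : ℕ} (hk : k ≤ ℓ + 1) (hinf : Fin.last (ℓ + 2) ∈ arc p k) :
    (arc p k)ᶜ = vblock ℓ (p.val + k - (ℓ + 3)) (p.val - 1) := by
  have hp : ((Fin.last (ℓ + 2) - p : Fin (ℓ + 3)) : ℕ) = ℓ + 2 - p.val := by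
    rw [Fin.coe_sub_iff_le.2 (Fin.le_last p), Fin.val_last]
  rw [mem_arc, hp] at hinf
  ext v
  rw [Finset.mem_compl, mem_arc, mem_vblock]
  by_cases h : p ≤ v
  · have h1 := Fin.coe_sub_iff_le.2 h
    have h2 : p.val ≤ v.val := h
    rw [h1]; have := v.isLt; omega
  · have h1 := Fin.coe_sub_iff_lt.2 (not_le.1 h)
    have h2 : v.val < p.val := not_le.1 h
    rw [h1]; omega

/-- **The block criterion gives Brown's condition** (bijective `σ`, homogeneous exponents): chords through `∞`
are handled by the complementary chord. -/
theorem brownConvergent_of_crit (hσ : Function.Bijective σ) (hh : Homogeneous σ a b)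
    (hc : (cellEdges σ hσ.1).Crit (cellExp σ a b)) : BrownConvergent σ a b := by
  intro p k'
  have hk : (2 : ℕ) ≤ (k' : ℕ) + 2 := by omega
  have hk' : (k' : ℕ) + 2 ≤ ℓ + 1 := by have := k'.isLt; omega
  suffices hS : 1 ≤ blockExp σ a b (arc p ((k' : ℕ) + 2)) by
    rw [twoOrd_eq_twoOrdSet_arc, twoOrdSet_eq_two_mul σ a b hσ hh]; omega
  by_cases hinf : Fin.last (ℓ + 2) ∈ arc p ((k' : ℕ) + 2)
  · -- chord through `∞`: use the complement, a linear block of finite points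
    have hp : ((Fin.last (ℓ + 2) - p : Fin (ℓ + 3)) : ℕ) = ℓ + 2 - p.val := by
      rw [Fin.coe_sub_iff_le.2 (Fin.le_last p), Fin.val_last]
    have hinf' := hinf
    rw [mem_arc, hp] at hinf'
    have hcompl : blockExp σ a b (arc p ((k' : ℕ) + 2)) = blockExp σ a b (arc p ((k' : ℕ) + 2))ᶜ := by
      have h1 := twoOrdSet_eq_two_mul σ a b hσ hh (arc p ((k' : ℕ) + 2))
      have h2 := twoOrdSet_eq_two_mul σ a b hσ hh (arc p ((k' : ℕ) + 2))ᶜ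
      rw [twoOrdSet_compl] at h2
      omega
    rw [hcompl, compl_arc_eq_vblock p hk' hinf]
    have := p.isLt
    exact one_le_blockExp_of_crit σ a b hσ.1 hc (by omega) (by omega) (by omega)
  · -- chord at finite distance avoiding `∞`: a linear block
    have hp : ((Fin.last (ℓ + 2) - p : Fin (ℓ + 3)) : ℕ) = ℓ + 2 - p.val := by
      rw [Fin.coe_sub_iff_le.2 (Fin.le_last p), Fin.val_last]
    rw [mem_arc, hp, not_lt] at hinf
    have harc : arc p ((k' : ℕ) + 2) = vblock ℓ p.val (p.val + (k' : ℕ) + 1) := by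
      have h := arc_eq_vblock (ℓ := ℓ) (p := p.val) (q := p.val + (k' : ℕ) + 1) (by omega) (by omega)
      rw [show p.val + (k' : ℕ) + 1 - p.val + 1 = (k' : ℕ) + 2 by omega] at h
      rw [← h]
    rw [harc]
    exact one_le_blockExp_of_crit σ a b hσ.1 hc (by omega) (by omega) (by omega)

/-- **Brown 2016, Lemma 3.6 / Def. 5.1, analytic form — full identification**: for a bijective seating and
homogeneous exponents, the generalised cellular integrand is integrable on the open simplex IFF Brown's
combinatorial condition `BrownConvergent σ a b` holds. [Brown2016, §2.4 (2.3), Lemma 3.6, Def. 5.1] -/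
theorem integrableOn_integrand_iff_brownConvergent (hσ : Function.Bijective σ) (hh : Homogeneous σ a b) :
    IntegrableOn (integrand σ a b) (openSimplex ℓ) ↔ BrownConvergent σ a b :=
  ⟨fun h => brownConvergent_of_crit σ a b hσ hh
      (((cellEdges σ hσ.1).integrableOn_powProd_iff_crit (cellExp σ a b)).1
        ((integrableOn_integrand_iff_powProd σ hσ.1 a b).1 h)),
    integrableOn_integrand_of_brownConvergent σ a b hσ hh⟩

/-- **Brown 2016, §1.5 / Lemma 3.6**: the basic cellular integral `I_σ(N)` (`N ≥ 0`) of a bijective seating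
converges IFF the seating is convergent. -/
theorem integrableOn_basic_iff_convergent (hσ : Function.Bijective σ) {N : ℤ} (hN : 0 ≤ N) :
    IntegrableOn (basic σ N) (openSimplex ℓ) ↔ Convergent σ := by
  rw [← brownConvergent_basic_iff_convergent hσ hN]
  exact integrableOn_integrand_iff_brownConvergent σ _ _ hσ (homogeneous_const σ N)

end Summit.KontsevichZagierPeriods.Zeta5Search.Families.Cellular
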